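import Literature.NumberTheory.EllipticCurves.Castella2018.AnticyclotomicSelmerDual
import Literature.NumberTheory.EllipticCurves.HeegnerPoints
import HarnessLib

/-!
# Lei–Müller–Xia 2023/24, Lemma 3.4: at `p ≥ 3` split in `K`, the Pontryagin dual of the
# `Σ₀`-IMPRIMITIVE BDP Selmer group `Sel^{BDP}_{Σ₀}(K_∞, E[p^∞])` over the anticyclotomic tower, IF
# `Λ`-torsion, has NO non-trivial FINITE `Λ`-submodule — ordinary and non-ordinary alike (typed
# STATEMENT, cite-only named fact, read for `f = f_E`)

Topic `Literature/NumberTheory/EllipticCurves`, sub-directory `LeiMullerXia2023` (namespace = path).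
Cell `pub/bsd-wall` (BSD summit, rung W-ALL, row 2·3@3), literature-typer seat `bsd-wall-utd-ty1` g8
(explicit unit, `--supports stmt-BirchSwinnertonDyer-23594`). HONEST FRAMING: ONE statement-only
named fact (`def … : Prop`, D-0014; nothing asserted, no `_holds`, no instance, no notation) in the
currency of the tree's `Castella2018.AcSelmer.XAc` (the `Λ`-dual of `Sel_𝔭^Σ(K_∞, E[p^∞])` that carries
the BSD routes' BDP-type main conjectures). Typed ≠ proved ≠ endorsed; BSD is not advanced here.

## Why (consumer)

The UTD lines at `p = 3`, `a_3 = 0` (cruxes ♭C₀_T stmt-27173 / ♭B′ stmt-27401) argue with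
`λ`-invariants of `X_ac` and with layer-`0` certificates ("`#Sel_{𝔭'}(K, W'[3^∞])[3] ≤ 3^{λ(X')}` for
`X'` torsion, `μ = 0`, NO FINITE SUBMODULE", utd-idea g25 `BaseLayerDegreeCertificate`); the tree's
UTD theorem files cite [LeiMullerXia2023] Lemma 3.5 / Cor. 3.8 / Thm. B in docstrings and re-prove the
algebra Summits-side, but the printed structural input "no finite submodule" for the BDP Selmer dual
— valid at `p = 3`, for supersingular AND ordinary `p` — had no Literature name. This file gives it
one, for the `Σ₀`-IMPRIMITIVE group exactly as printed (flag `imprimitive` below: the PRIMITIVE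
statement is NOT printed in [LeiMullerXia2023]).

## Source, VERBATIM (held text `paper:arxiv-2302.06553`; = Forum Math. 36 (2024) 153–172,
doi:10.1515/forum-2023-0049; bib key `LeiMullerXia2023`)

* §1 (p. 3): "Let `K` be an imaginary quadratic field with discriminant `d_K`. Throughout this article,
  `p ≥ 3` is a fixed prime number that is split in `K`. We fix once and for all an embedding
  `ℚ̄ ↪ ℚ̄_p` and let `𝔭` be the prime of `K` above `p` determined by this embedding … Let `f` be a
  normalized newform … of `S₂(Γ₀(N), 𝒪)` … Let `K_∞` be the anticyclotomic `ℤ_p`-extension of `K`. We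
  assume that the class number of `K` is coprime to `p`. … We assume that `N` is coprime to `pd_K` and
  we factorize `N` into a product `N⁺N⁻` … (GHH) `N⁻` is the square-free product of an even number of
  primes"; "For `i ∈ {1,2}`, let `f_i ∈ S₂(Γ₀(N_i), 𝒪)` be a newform … Suppose that `p ∤ N₁N₂` … The
  `p`-adic Tate module of the abelian variety attached to `f_i` determines a `G_ℚ`-stable lattice
  `T_i ⊂ V_i`. We define `A_i = V_i/T_i` … (Cong) `ρ̄₁ ≃ ρ̄₂`"; "(H0) `H⁰(K_w, A_i) = {0}` for all
  `w ∣ pN⁻₁N⁻₂` and `i ∈ {1,2}`".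
* §3 (p. 7): "Throughout, we fix `f_i ∈ S₂(Γ₀(N_i), 𝒪)` for `i ∈ {1,2}` satisfying the conditions
  (GHH), (cong) and (H0). Note that the hypothesis (H0) implies that `H⁰(K, A_i) = H⁰(K_∞, A_i) = 0`."
  **Definition 3.2.** "Let `Σ` be the set of all primes dividing `N₁N₂p` and let `Σ₀` be the set of
  primes dividing `N⁺₁N⁺₂`. We define the BDP Selmer group of `f_i` over `K_n` by `Sel^{BDP}(K_n, A_i)
  = ker(H¹(K_Σ/K_n, A_i) → ∏_{w∣Σ∖{𝔭^c}} H¹(K_{n,w}, A_i))` and the imprimitive BDP Selmer group (with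
  respect to `Σ₀`) `Sel^{BDP}_{Σ₀}(K_n, A_i) = ker(H¹(K_Σ/K_n, A_i) → ∏_{w∣Σ∖(Σ₀∪{𝔭^c})} H¹(K_{n,w}, A_i))`
  … In the standard definition of BDP Selmer groups, one usually requires the cocycles to be
  unramified at primes away from `p` instead of trivial … It then follows from [Kidwell] that our
  definition of BDP Selmer groups coincides with the standard one." **Lemma 3.4.** "If the
  `Λ^{ac}_{𝒪_v}`-module `Sel^{BDP}_{Σ₀}(K_∞, A_i)^∨` is torsion, then it does not contain a non-trivial
  finite submodule." (Proof, p. 8: twist `B_t = A_i ⊗ κ^t`; [Greenberg 1989] gives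
  `rank H²(K_Σ/K_∞, B_t)^∨ = 0` and no finite submodule in `H¹(K_Σ/K_∞, B_t)^∨`, so
  `H¹(K_Σ/K_∞, B_t)_{Γ^{ac}} = 0`; the surjectivity of Lemma 3.3 at `n = 0` and
  `H⁰(K_∞, B_t) = 0` then give `Sel^{BDP}_{Σ₀}(K_∞, B_t)_{Γ^{ac}} = 0`, "which implies that
  `Sel^{BDP}_{Σ₀}(K_∞, B_t)^∨` does not contain a nontrivial finite submodule".)

## Transcription (READING FLAGS)

* `E-reading` (literal here): for `f = f_E`, `E/ℚ` elliptic of conductor `N`, LMX's `T` IS "the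
  `p`-adic Tate module of the abelian variety attached to `f`" = `T_p E`, `A = E[p^∞]`, `𝒪_v = ℤ_p`,
  `Λ^{ac}_{𝒪_v} = ℤ_p⟦Γ^{ac}⟧ = ℤ_p⟦T⟧` (`T = γ − 1`); a single form (`f₁ = f₂ = f_E`, (Cong) trivial,
  `N₁ = N₂ = N`, `Σ₀` = the primes of `K` above `N⁺`).
* `K_∞-formulation` / `away-p`: LMX's `Sel^{BDP}_{Σ₀}(K_∞, A) = lim→_n` is read, by Shapiro's lemma (the
  docstring step of `Castella2018.AcSelmer`), as a subgroup of `H¹(K_∞, E[p^∞])`: TRIVIAL at every place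
  above `𝔭` and above the finite `w ∉ Σ₀`, `w ∤ p` (at `w ∣ Σ ∖ (Σ₀ ∪ {𝔭^c})` this is LMX's condition
  verbatim — they impose triviality, not unramifiedness —, and at a good `w ∉ Σ` unramified classes
  over `K_∞` are trivial: `H¹_{ur}(K_{∞,w}, E[p^∞]) = 0`, the residual Galois group of `K_{∞,w}` being
  pro-prime-to-`p` or `Frob_w − 1` being onto the divisible group `E[p^∞]`), NO condition above `𝔭^c`
  and above `Σ₀` — i.e. EXACTLY the tree's `Castella2018.AcSelmer.selmerAc (W⁄K) p κ 𝔭 Σ₀` (strict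
  above `𝔭`, relaxed above the other prime over `p`, locally trivial above finite `w ∉ Σ₀`, `w ∤ p`),
  whose dual is `AcSelmer.XAc (W⁄K) p κ 𝔭 Σ₀ γ` with its CONSTRUCTED `Λ`-module structure.
* `strict-prime`: LMX's `𝔭` is the prime singled out by the fixed embedding `ℚ̄ ↪ ℚ̄_p`; either prime
  above `p` can play this role (change the embedding), so the fact is stated for every `𝔭 ∋ p`.
* `GHH→Heeg`: (GHH) is transcribed in the case `N⁻ = 1` (every prime dividing `N` splits,
  `SatisfiesHeegnerHypothesis`; then `Σ₀` = all primes above `N`, "(N, d_K) = 1" is implied, and (H0)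
  only concerns `w ∣ p`) — TODO(general form): `N⁻` a square-free product of an even number of inert
  primes, with (H0) also at `w ∣ N⁻`.
* `(H0)`: "`H⁰(K_w, A) = 0` for `w ∣ p`" = `E(K_w)[p^∞] = 0` at both primes above `p` (`K_w ≅ ℚ_p`):
  automatic at a supersingular `p ≥ 3` (`AcSigned.bdKim2013_prop32_localPoints_noPTorsion`), the
  non-anomaly condition `a_p ≢ 1 (mod p)` at an ordinary `p`; carried as a binder on the `K_w`-points.
* `torsion`: "is torsion" for the finitely generated `Λ`-module `X_ac^{Σ₀}` (finite generation is the
  tree's theorem `Castella2018.AcSelmer.XAc.module_finite`, `Σ₀` finite) = `Module.IsTorsion`.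
* `imprimitive`: the lemma is printed for the `Σ₀`-IMPRIMITIVE group; the quotient
  `X^{Σ₀}_ac ↠ X^∅_ac` has kernel `(∏_{w∣Σ₀} H¹(K_{∞,w}, A))^∨` and "no finite submodule" does NOT
  descend to quotients in general — the primitive statement is not claimed.

## NOT in this file
Lemma 3.3 (surjectivity of the global-to-local map when cotorsion), Lemma 3.5 / Cor. 3.8 / Thm. A =
Cor. 3.9 (`λ(X^{BDP}(f₁)) + Σ c_{ℓ,1} = λ(X^{BDP}(f₂)) + Σ c_{ℓ,2}` under (Cong), (H0), `μ = 0`) and the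
analytic §4–5: the UTD theorem files re-prove the algebra they need Summits-side
(`UniversalToricDescentDefectTransportOfSigmaCongruence`, `…AnticyclotomicEulerFactor`); typable on
request in this namespace.
-/

noncomputable section

open scoped Classical

open NumberField IsDedekindDomain Field
open Literature.NumberTheory.EllipticCurves Literature.NumberTheory.GaloisRepresentations
open Literature.NumberTheory.EllipticCurves.Castella2018

namespace Literature.NumberTheory.EllipticCurves.LeiMullerXia2023

variable (W : WeierstrassCurve ℚ) (K : Type) [Field K] [NumberField K]
  (p : ℕ) [Fact p.Prime] (κ : ZpExtension K p) (𝔭 𝔭' : HeightOneSpectrum (𝓞 K))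

/-- **The imprimitivity set `Σ₀` of [LeiMullerXia2023] Def. 3.2 for a single curve of conductor `N`
under the Heegner hypothesis: the primes of `K` above `N⁺ = N`** ("let `Σ₀` be the set of primes
dividing `N⁺₁N⁺₂`"; here `N₁ = N₂ = N`, `N⁻ = 1`). [cite: LeiMullerXia2023, Def. 3.2 (arXiv:2302.06553 p. 7)] -/
def sigmaZero (N : ℕ) : Set (HeightOneSpectrum (𝓞 K)) :=
  {v | ((N : ℕ) : 𝓞 K) ∈ v.asIdeal}

omit [NumberField K] in
/-- Membership in `Σ₀`: `v ∣ N`. [cite: LeiMullerXia2023, Def. 3.2 (arXiv:2302.06553 p. 7)] -/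
@[simp] theorem mem_sigmaZero_iff (N : ℕ) (v : HeightOneSpectrum (𝓞 K)) :
    v ∈ sigmaZero K N ↔ ((N : ℕ) : 𝓞 K) ∈ v.asIdeal := Iff.rfl

variable [W.IsGloballyMinimal]

/-- **Lei–Müller–Xia 2023/24, Lemma 3.4, read for `f = f_E`: if the `Λ`-dual `X^{Σ₀}_ac` of the
`Σ₀`-imprimitive BDP Selmer group `Sel^{BDP}_{Σ₀}(K_∞, E[p^∞])` is `Λ`-torsion, it has NO non-trivial
finite `Λ`-submodule.** Printed: "Lemma 3.4. If the `Λ^{ac}_{𝒪_v}`-module `Sel^{BDP}_{Σ₀}(K_∞, A_i)^∨` is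
torsion, then it does not contain a non-trivial finite submodule", under the standing hypotheses of
§1/§3: "`p ≥ 3` is a fixed prime number that is split in `K`", `𝔭` the prime above `p` of the fixed
embedding, "the class number of `K` is coprime to `p`", `f ∈ S₂(Γ₀(N), 𝒪)` a newform with "`N` coprime
to `pd_K`", (GHH), (Cong) (void for a single form) and "(H0) `H⁰(K_w, A) = {0}` for all `w ∣ pN⁻`";
`K_∞` the anticyclotomic `ℤ_p`-extension; Def. 3.2 (`Σ₀` = primes dividing `N⁺`; conditions TRIVIAL at
`w ∣ Σ ∖ (Σ₀ ∪ {𝔭^c})`, none at `𝔭^c` and at `Σ₀`). TRANSCRIBED for `E/ℚ` elliptic (globally minimal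
model `W`, to read `N` and good reduction `p ∤ N`) of conductor `N`, `K` imaginary quadratic with every
prime dividing `N` split (`SatisfiesHeegnerHypothesis`, the case `N⁻ = 1` of (GHH); flag `GHH→Heeg`),
`p ≠ 2`, `p = 𝔭𝔭'` split (`𝔭' ≠ 𝔭` above `p`), `p ∤ h_K`, `κ` anticyclotomic, (H0) as "`E(K_w)` has no
`p`-power torsion for `w ∈ {𝔭, 𝔭'}`" on the `K_w`-points of the model (`K_w = w.adicCompletion K`;
flag `(H0)`), "torsion" as `Module.IsTorsion` (flag `torsion`), on the tree's object
`Castella2018.AcSelmer.XAc (W⁄K) p κ 𝔭 Σ₀ γ` for every topological generator `γ` (instance argument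
`Fact (κ.IsTopGenerator γ)`), `Σ₀ = sigmaZero K N` (flags `E-reading`, `K_∞-formulation`, `strict-prime`,
`imprimitive`): every FINITE `Λ`-submodule is `⊥`. Usable at `p = 3` for `a_3 = 0` (supersingular: (H0)
automatic) and for ordinary non-anomalous `p`. Size L (Greenberg 1989's structure of
`H^i(K_Σ/K_∞, B_t)`, twisting, Lemma 3.3); no `_holds`.
[cite: LeiMullerXia2023, Lemma 3.4 with Def. 3.2, §1 standing hypotheses and (H0) (arXiv:2302.06553 pp. 3, 7–8)] -/
def lemma34_XAc_noFiniteSubmodule : Prop :=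
  ∀ (_ : W.IsElliptic) (_ : IsImaginaryQuadratic K) (N : ℕ), (W.conductorNorm ℤ : ℕ) = N → ¬ p ∣ N →
    SatisfiesHeegnerHypothesis N K → p ≠ 2 →
    ((p : ℕ) : 𝓞 K) ∈ 𝔭.asIdeal → ((p : ℕ) : 𝓞 K) ∈ 𝔭'.asIdeal → 𝔭' ≠ 𝔭 →
    ¬ p ∣ NumberField.classNumber K → κ.IsAnticyclotomic →
    -- (H0) at the two primes above `p`: `E(K_w)[p^∞] = 0`
    (∀ w : HeightOneSpectrum (𝓞 K), ((p : ℕ) : 𝓞 K) ∈ w.asIdeal →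
      ∀ (P : (W.baseChange (w.adicCompletion K)).toAffine.Point) (k : ℕ), p ^ k • P = 0 → P = 0) →
    ∀ (γ : absoluteGaloisGroup K) [Fact (κ.IsTopGenerator γ)],
      Module.IsTorsion (IwasawaAlgebra p) (AcSelmer.XAc (W.baseChange K) p κ 𝔭 (sigmaZero K N) γ) →
      ∀ M : Submodule (IwasawaAlgebra p) (AcSelmer.XAc (W.baseChange K) p κ 𝔭 (sigmaZero K N) γ),
        Finite M → M = ⊥

end Literature.NumberTheory.EllipticCurves.LeiMullerXia2023

end
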